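import Literature.Computability.Cryptography.LWENoiseWidth
import HarnessLib

/-!
# A small shift does not change `D_t` / `Ψ_t` by much: `Δ(D_t, δ + D_t) ≤ |δ|/t`

Topic `Computability/Cryptography` (LWE noise), grouping namespace `LWE`; sequel of `LWENoiseWidth.lean`
(`widthVar t = t²/(2π)`, `gaussianPDFReal_width`: the density `t⁻¹ e^{-πx²/t²}` of `D_t = gaussianReal 0
(widthVar t)`; `Ψ_t = wrappedGaussian t`, its image in `𝕋`). Proved glue (no named fact) for pqc.S19–S21:
the statistical distance between a centred Gaussian of width `t` and its translate by `δ` is at most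
`|δ|/t` (in fact `= D_t([-|δ|/2, |δ|/2))`). This is the tool by which a bounded perturbation `|δ| ≤ 1/(2Q)` of
a sample — the rounding error when the DISCRETISED interfaces `Ψ̄` (`⌊Q·⌉ mod Q`, `LWENoise.lean`) of the
tree's LWE problems are fed back into the continuous transformations of Regev 2009 / Peikert 2009 /
BLPRS 2013, which subsequently add fresh Gaussian noise of width `t` — is absorbed at cost `≤ 1/(2Qt)` in
statistical distance per sample (e.g. the interfaces `I₁, I₂` of `BLPRSReduction.lean`, whose modulus is
`Q = 2^{⌊d/2⌋+2}`).

## Results (`0 < t`, any `δ`, every measurable event)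

* `gaussianPDFReal_le_shift_iff` — for `δ > 0`: `p₀(x) ≤ p_δ(x) ↔ δ/2 ≤ x` (`p_δ = p₀(· - δ)` the density of
  `gaussianReal δ (widthVar t)`);
* `measureReal_gaussianReal_shift_sub_le` — `γ_δ(A) - γ₀(A) ≤ δ/t` for `δ ≥ 0`:
  `∫_A (p_δ - p₀) ≤ ∫_{x ≥ δ/2} (p_δ - p₀) = γ₀([-δ/2, δ/2)) ≤ δ · p₀(0) = δ/t`;
* **`abs_measureReal_gaussianReal_shift_sub_le`** — `|γ₀(A) - γ_δ(A)| ≤ |δ|/t` (complements for the other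
  sign, the reflection `x ↦ -x` for `δ < 0`);
* **`abs_measureReal_wrappedGaussian_shift_sub_le`** — on the torus: `|Ψ_t(B) - (δ + Ψ_t)(B)| ≤ |δ|/t`, where
  `δ + Ψ_t = (wrappedGaussian t).map (δ + ·)` (`= (gaussianReal δ (widthVar t)).map (↑)`,
  `map_const_add_wrappedGaussian`).

## References

* Folklore (total variation between translates of a Gaussian); used implicitly wherever Regev 2009 §2 /
  BLPRS 2013 §2.3 pass between `Ψ_α` on `𝕋` and its discretisation `Ψ̄_α` on `ℤ_q`
  [RegevLWE2009, §2; BrakerskiEtAl2013, §2.3].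
-/

noncomputable section

open MeasureTheory ProbabilityTheory Set
open scoped NNReal

namespace Literature.Computability.Cryptography

namespace LWE

/-! ### The densities of `D_t` and of its translate -/

/-- The density of the translate: `gaussianPDFReal δ (widthVar t) x = t⁻¹ e^{-π(x-δ)²/t²}`. [folklore] -/
theorem gaussianPDFReal_shift_width {t : ℝ} (ht : 0 < t) (δ x : ℝ) :
    gaussianPDFReal δ (widthVar t) x = t⁻¹ * Real.exp (-(Real.pi * (x - δ) ^ 2 / t ^ 2)) := by
  rw [show δ = 0 + δ from (zero_add δ).symm, ← gaussianPDFReal_sub, gaussianPDFReal_width ht]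
  simp

/-- The density is at most its value at the centre, `t⁻¹`. [folklore] -/
theorem gaussianPDFReal_width_le_inv {t : ℝ} (ht : 0 < t) (x : ℝ) :
    gaussianPDFReal 0 (widthVar t) x ≤ t⁻¹ := by
  rw [gaussianPDFReal_width ht]
  have h : Real.exp (-(Real.pi * x ^ 2 / t ^ 2)) ≤ 1 := by
    rw [Real.exp_le_one_iff, neg_nonpos]; positivity
  calc t⁻¹ * Real.exp (-(Real.pi * x ^ 2 / t ^ 2)) ≤ t⁻¹ * 1 :=
        mul_le_mul_of_nonneg_left h (inv_nonneg.2 ht.le)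
    _ = t⁻¹ := mul_one _

/-- **Where the translate dominates**: for `δ > 0`, `p₀(x) ≤ p_δ(x) ↔ δ/2 ≤ x`
(`(x - δ)² ≤ x² ↔ δ ≤ 2x`). [folklore] -/
theorem gaussianPDFReal_le_shift_iff {t δ : ℝ} (ht : 0 < t) (hδ : 0 < δ) (x : ℝ) :
    gaussianPDFReal 0 (widthVar t) x ≤ gaussianPDFReal δ (widthVar t) x ↔ δ / 2 ≤ x := by
  rw [gaussianPDFReal_width ht, gaussianPDFReal_shift_width ht,
    mul_le_mul_iff_right₀ (inv_pos.2 ht), Real.exp_le_exp, neg_le_neg_iff,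
    div_le_div_iff_of_pos_right (by positivity), mul_le_mul_iff_right₀ Real.pi_pos]
  constructor
  · intro h; nlinarith
  · intro h; nlinarith

/-! ### The one-sided bound for `δ ≥ 0` -/

/-- The measure of an event under the translate, as the integral of its density. [folklore] -/
theorem measureReal_gaussianReal_shift {t : ℝ} (ht : 0 < t) (δ : ℝ) (A : Set ℝ) :
    (gaussianReal δ (widthVar t)).real A = ∫ x in A, gaussianPDFReal δ (widthVar t) x := by
  rw [measureReal_def, gaussianReal_apply_eq_integral _ (widthVar_ne_zero ht),
    ENNReal.toReal_ofReal (integral_nonneg fun x => gaussianPDFReal_nonneg _ _ x)]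

/-- The translate of an event: `γ_δ(A) = γ₀(A - δ)`, i.e. `γ_δ = γ₀.map (· + δ)`. [folklore] -/
theorem measureReal_gaussianReal_shift_eq_preimage {t : ℝ} (δ : ℝ) {A : Set ℝ} (hA : MeasurableSet A) :
    (gaussianReal δ (widthVar t)).real A = (gaussianReal 0 (widthVar t)).real ((fun x => x + δ) ⁻¹' A) := by
  rw [← zero_add δ, ← gaussianReal_map_add_const δ, zero_add, measureReal_def, measureReal_def,
    Measure.map_apply (measurable_add_const δ) hA]

/-- **`γ_δ(A) - γ₀(A) ≤ δ/t` for `δ ≥ 0`.** With `H = {x | δ/2 ≤ x}` (where `p_δ ≥ p₀`):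
`∫_A (p_δ - p₀) ≤ ∫_{A ∩ H} (p_δ - p₀) ≤ ∫_H (p_δ - p₀) = γ_δ(H) - γ₀(H) = γ₀([-δ/2, ∞)) - γ₀([δ/2, ∞))
= γ₀([-δ/2, δ/2)) ≤ δ · t⁻¹`. [folklore] -/
theorem measureReal_gaussianReal_shift_sub_le {t δ : ℝ} (ht : 0 < t) (hδ : 0 ≤ δ) {A : Set ℝ}
    (hA : MeasurableSet A) :
    (gaussianReal δ (widthVar t)).real A - (gaussianReal 0 (widthVar t)).real A ≤ δ / t := by
  rcases hδ.eq_or_lt with rfl | hδpos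
  · simp
  have hi₀ : Integrable (gaussianPDFReal 0 (widthVar t)) := integrable_gaussianPDFReal _ _
  have hiδ : Integrable (gaussianPDFReal δ (widthVar t)) := integrable_gaussianPDFReal _ _
  have hif : Integrable (fun x => gaussianPDFReal δ (widthVar t) x - gaussianPDFReal 0 (widthVar t) x) :=
    hiδ.sub hi₀
  have hHm : MeasurableSet (Ici (δ / 2)) := measurableSet_Ici
  -- the difference as one integral
  have hdiff : (gaussianReal δ (widthVar t)).real A - (gaussianReal 0 (widthVar t)).real A =
      ∫ x in A, (gaussianPDFReal δ (widthVar t) x - gaussianPDFReal 0 (widthVar t) x) := by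
    rw [measureReal_gaussianReal_shift ht δ A, measureReal_gaussianReal_shift ht 0 A,
      integral_sub hiδ.integrableOn hi₀.integrableOn]
  rw [hdiff]
  -- restrict to `A ∩ H` (the integrand is `≤ 0` off `H`), then enlarge to `H` (it is `≥ 0` on `H`)
  have hsplit := integral_inter_add_sdiff hHm (hif.integrableOn (s := A))
  have hneg : ∫ x in A \ Ici (δ / 2), (gaussianPDFReal δ (widthVar t) x - gaussianPDFReal 0 (widthVar t) x) ≤ 0 := by
    refine setIntegral_nonpos (hA.diff hHm) fun x hx => ?_
    have hx' : ¬ δ / 2 ≤ x := hx.2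
    rw [← gaussianPDFReal_le_shift_iff ht hδpos x] at hx'
    linarith [not_le.1 hx']
  have hmono : ∫ x in A ∩ Ici (δ / 2), (gaussianPDFReal δ (widthVar t) x - gaussianPDFReal 0 (widthVar t) x) ≤
      ∫ x in Ici (δ / 2), (gaussianPDFReal δ (widthVar t) x - gaussianPDFReal 0 (widthVar t) x) := by
    refine setIntegral_mono_set hif.integrableOn ?_ (Filter.Eventually.of_forall inter_subset_right)
    refine (ae_restrict_iff' hHm).2 (ae_of_all _ fun x hx => ?_)
    have hx' : δ / 2 ≤ x := hx
    rw [← gaussianPDFReal_le_shift_iff ht hδpos x] at hx'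
    simp only [Pi.zero_apply]; linarith
  -- `∫_H (p_δ - p₀) = γ₀([-δ/2, δ/2))`
  have hHint : ∫ x in Ici (δ / 2), (gaussianPDFReal δ (widthVar t) x - gaussianPDFReal 0 (widthVar t) x) =
      (gaussianReal 0 (widthVar t)).real (Ico (-(δ / 2)) (δ / 2)) := by
    rw [integral_sub hiδ.integrableOn hi₀.integrableOn, ← measureReal_gaussianReal_shift ht δ,
      ← measureReal_gaussianReal_shift ht 0, measureReal_gaussianReal_shift_eq_preimage δ hHm]
    have hpre : (fun x => x + δ) ⁻¹' Ici (δ / 2) = Ici (-(δ / 2)) := by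
      ext x; simp only [mem_preimage, mem_Ici]; constructor <;> intro h <;> linarith
    have hdisj : Disjoint (Ico (-(δ / 2)) (δ / 2)) (Ici (δ / 2)) :=
      Set.disjoint_left.2 fun x hx hx2 => absurd (mem_Ici.1 hx2) (not_le.2 hx.2)
    rw [hpre, ← Ico_union_Ici_eq_Ici (show -(δ / 2) ≤ δ / 2 by linarith),
      measureReal_union hdisj measurableSet_Ici]
    ring
  -- `γ₀([-δ/2, δ/2)) ≤ δ t⁻¹`
  have hIco : (gaussianReal 0 (widthVar t)).real (Ico (-(δ / 2)) (δ / 2)) ≤ δ / t := by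
    rw [measureReal_gaussianReal_width ht]
    have hvol : volume (Ico (-(δ / 2)) (δ / 2)) < ⊤ := by simp
    have h := norm_setIntegral_le_of_norm_le_const hvol (f := gaussianPDFReal 0 (widthVar t)) (C := t⁻¹)
      fun x _ => by
        rw [Real.norm_of_nonneg (gaussianPDFReal_nonneg _ _ x)]; exact gaussianPDFReal_width_le_inv ht x
    rw [Real.norm_of_nonneg (integral_nonneg fun x => gaussianPDFReal_nonneg _ _ x),
      Real.volume_real_Ico_of_le (by linarith)] at h
    calc ∫ x in Ico (-(δ / 2)) (δ / 2), gaussianPDFReal 0 (widthVar t) x ≤ t⁻¹ * (δ / 2 - -(δ / 2)) := h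
      _ = δ / t := by ring
  linarith [hsplit, hneg, hmono, hHint, hIco]

/-! ### Both signs, both directions -/

/-- `|γ₀(A) - γ_δ(A)| ≤ δ/t` for `δ ≥ 0` (the other direction through complements: both are probability
measures). [folklore] -/
theorem abs_measureReal_gaussianReal_shift_sub_le_of_nonneg {t δ : ℝ} (ht : 0 < t) (hδ : 0 ≤ δ)
    {A : Set ℝ} (hA : MeasurableSet A) :
    |(gaussianReal 0 (widthVar t)).real A - (gaussianReal δ (widthVar t)).real A| ≤ δ / t := by
  rw [abs_sub_le_iff]
  constructor
  · have h := measureReal_gaussianReal_shift_sub_le ht hδ hA.compl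
    rw [probReal_compl_eq_one_sub hA, probReal_compl_eq_one_sub hA] at h
    linarith
  · exact measureReal_gaussianReal_shift_sub_le ht hδ hA

/-- Reflection: `γ_δ(A) = γ_{-δ}(-A)`. [folklore] -/
theorem measureReal_gaussianReal_neg_preimage {t : ℝ} (δ : ℝ) {A : Set ℝ} (hA : MeasurableSet A) :
    (gaussianReal (-δ) (widthVar t)).real (Neg.neg ⁻¹' A) = (gaussianReal δ (widthVar t)).real A := by
  have hset : (fun x : ℝ => -x) ⁻¹' (Neg.neg ⁻¹' A) = A := by ext x; simp
  rw [← gaussianReal_map_neg, measureReal_def, measureReal_def,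
    Measure.map_apply measurable_neg (measurable_neg hA), hset]

/-- **`|γ₀(A) - γ_δ(A)| ≤ |δ|/t`**: the statistical distance between the centred Gaussian of width `t`
and its translate by `δ` is at most `|δ|/t`, event by event. [folklore] -/
theorem abs_measureReal_gaussianReal_shift_sub_le {t : ℝ} (ht : 0 < t) (δ : ℝ) {A : Set ℝ}
    (hA : MeasurableSet A) :
    |(gaussianReal 0 (widthVar t)).real A - (gaussianReal δ (widthVar t)).real A| ≤ |δ| / t := by
  rcases le_or_gt 0 δ with hδ | hδ
  · rw [abs_of_nonneg hδ]; exact abs_measureReal_gaussianReal_shift_sub_le_of_nonneg ht hδ hA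
  · rw [abs_of_neg hδ, ← measureReal_gaussianReal_neg_preimage δ hA,
      ← measureReal_gaussianReal_neg_preimage 0 hA, neg_zero]
    exact abs_measureReal_gaussianReal_shift_sub_le_of_nonneg ht (by linarith) (measurable_neg hA)

/-! ### On the torus -/

/-- The translate of `Ψ_t` by `δ` is the image of the translated Gaussian:
`(wrappedGaussian t).map (δ + ·) = (gaussianReal δ (widthVar t)).map (↑)`. [folklore] -/
theorem map_const_add_wrappedGaussian (t δ : ℝ) :
    (wrappedGaussian t).map (fun y : UnitAddCircle => ((δ : ℝ) : UnitAddCircle) + y) =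
      (gaussianReal δ (widthVar t)).map (fun x : ℝ => (x : UnitAddCircle)) := by
  rw [wrappedGaussian, Measure.map_map (measurable_const_add _) measurable_coe_unitAddCircle,
    ← zero_add δ, ← gaussianReal_map_const_add δ, zero_add,
    Measure.map_map measurable_coe_unitAddCircle (measurable_const_add δ)]
  rfl

/-- **`|Ψ_t(B) - (δ + Ψ_t)(B)| ≤ |δ|/t`** for every measurable `B ⊆ 𝕋`: translating the torus noise `Ψ_t`
by (the class of) `δ` moves every event by at most `|δ|/t` ("applying a function cannot increase the
statistical distance", here `ℝ → 𝕋`). [folklore] -/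
theorem abs_measureReal_wrappedGaussian_shift_sub_le {t : ℝ} (ht : 0 < t) (δ : ℝ) {B : Set UnitAddCircle}
    (hB : MeasurableSet B) :
    |(wrappedGaussian t).real B -
        ((wrappedGaussian t).map (fun y : UnitAddCircle => ((δ : ℝ) : UnitAddCircle) + y)).real B| ≤
      |δ| / t := by
  rw [map_const_add_wrappedGaussian, wrappedGaussian, measureReal_def, measureReal_def,
    Measure.map_apply measurable_coe_unitAddCircle hB, Measure.map_apply measurable_coe_unitAddCircle hB]
  exact abs_measureReal_gaussianReal_shift_sub_le ht δ (measurable_coe_unitAddCircle hB)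

end LWE

end Literature.Computability.Cryptography

end
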